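import Mathlib
import Literature.Analysis.FluidPDE.SelfSimilar
import HarnessLib

/-!
# Rotated-DSS and Type-I structure passes to blow-up (ladder / zoom) limits

Analysis/FluidPDE support file (everything proved; no definitions, no named facts).

In every extraction argument of Navier–Stokes blow-up theory a sequence of fields `uₙ` on the open
past `(−∞, 0) × E` carrying a SCALE-INVARIANT structure — the Type-I bound
`‖uₙ(t, x)‖ ≤ C₀ / (‖x‖ + √−t)` (Koch–Nadirashvili–Seregin–Šverák 2009, (1.6)) and (rotated)
discrete self-similarity `cₙ Rₙᵀ uₙ(cₙ² t, cₙ Rₙ x) = uₙ(t, x)` (Chae–Wolf 2017, Def. 1.1;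
Bradshaw–Tsai 2017) — is passed to a limit `v` by a compactness theorem (KNSS 2009, Lemma 6.1, tree:
`AncientMildCompactness.lean`), and one then needs that THE STRUCTURE SURVIVES: the limit is again
Type-I with the same constant (KNSS 2009, proof of Thm 6.2: "the `w⁽ᵏ⁾` converge uniformly on compact
subsets … to an ancient mild solution `w`" obeying the same bound), is again (rotated) DSS — with the
LIMIT factor and rotation when these vary along the sequence (Bradshaw–Tsai 2017, §5.1: "`v_l` is
DSS with scaling factor `λ_k`, and this property is inherited by `v`"; there with nested factors
`λ_{k+1}² = λ_k → 1`), and is NON-TRIVIAL when the approximants carry a quantitative amplitude floor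
at bounded distance. This file proves these passages once and for all, in a finite-dimensional real
normed space `E`, for sequences indexed by `ℕ`:

* `HasTypeIDecay.of_tendsto` — the Type-I class with constant `C` is closed under pointwise
  convergence on the open past; `HasTypeIDecay.norm_add_sqrt_le_div` — an amplitude `δ ≤ ‖u(t,x)‖`
  forces `‖x‖ + √−t ≤ C/δ` (the floor sits at bounded radius).
* `exists_ball_forall_norm_sub_le_of_tendsto` — the BAIRE-CATEGORY device behind everything with
  moving points (Osgood; Oxtoby, *Measure and Category*, Ch. 7, proof of Thm 7.3): if maps `fₙ`,
  continuous on an open set `U` of a complete metric space, converge POINTWISE on `U` to a map `g`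
  continuous on `U`, then every closed ball inside `U` contains an open ball on which
  `‖fₙ − g‖ ≤ ε` for all `n ≥ N`.
* `rotatedDSS_Iio_of_tendsto` — THE DSS IDENTITY PASSES TO POINTWISE LIMITS WITH CONVERGING FACTORS
  AND ROTATIONS: if `uₙ` are jointly continuous on the open past and satisfy the rotated-DSS identity
  there with factors `cₙ → c' > 0` and isometries `Rₙ → R'` (pointwise), and `uₙ → v` pointwise on the
  open past with `v` jointly continuous there, then `c' R'ᵀ v(c'² t, c' R' x) = v(t, x)` for all
  `t < 0`. (Slice-wise or pointwise convergence does not control `uₙ` at the MOVING points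
  `(cₙ² t, cₙ Rₙ x)`; the Baire device supplies an open set of uniform closeness near the limit point,
  and continuity of `v` closes the argument — no equicontinuity in time is assumed.)
* `isRotatedDSS_of_Iio_of_eq_zero`, `isRotatedDSS_cutoff_of_Iio` — the tree's `IsRotatedDSS c R v`
  quantifies over ALL `t ∈ ℝ`; a field known only on the past is made globally rotated-DSS by setting
  it to `0` on `t ≥ 0` (the identity there is `0 = 0`).
* `tendsto_linearIsometryEquiv_symm` — pointwise convergence of linear isometries `Rₙ → R'` gives
  `Rₙ⁻¹ yₙ → R'⁻¹ y` along `yₙ → y` (no locally uniform upgrade is needed: isometries are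
  `1`-Lipschitz).
* `exists_le_norm_of_tendstoLocallyUniformly` — an amplitude floor `δ ≤ ‖fₙ(xₙ)‖` at bounded points
  `‖xₙ‖ ≤ ρ` survives locally uniform convergence to a continuous limit (Bolzano–Weierstrass +
  `TendstoLocallyUniformly.tendsto_comp`); `not_ae_eq_zero_of_continuous_of_ne` — a continuous field
  that is nonzero at one point is not a.e. zero for an open-positive measure.
* `typeI_rotatedDSS_structure_of_tendsto` — the assembled STRUCTURE-PASSES statement: factors in
  `[c_min, ∞)` with `1 < c_min`, rotated-DSS Type-I approximants with amplitude `≥ δ` somewhere on the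
  slice `t = −1`, pointwise convergence on the open past plus locally uniform convergence on the
  slice `t = −1` to a field `v` continuous on the open past and vanishing on `t ≥ 0` ⟹ `1 < c'`,
  `IsRotatedDSS c' R' v`, `HasTypeIDecay C₀ v`, every past slice a.e.-strongly measurable, the
  amplitude floor `∃ x, δ ≤ ‖v(−1, x)‖`, and `¬ (∀ t < 0, v t =ᵐ 0)`.

Consumers: the "structure passes to the limit" half of any Type-I (r)DSS profile extraction
(KNSS 2009 §6; Chae–Wolf 2017; the angular-Galerkin-ladder limit transfer of
`Summits/NavierStokesRegularity/FluidComputer/AngularGalerkinLadder.lean`, whose window profiles are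
`IsRotatedDSS` + `HasTypeIDecay` + `∃ x, δ ≤ ‖u (−1) x‖`); the ancient-MILD clause of such statements
is equation-specific and is NOT here (for classical limits it is
`isAncientMildSolution_of_classical_Iio` on the Summits side; for Oseen-mild limits it is the output
of `exists_oseenMild_limit_of_monotone_bound`).

WHAT THIS IS NOT: nothing here asserts that any blow-up, ladder or zoom sequence exists or
converges; these are closure properties of two scale-invariant classes under limits that are GIVEN.

Design notes.
* Convergence hypotheses are the weakest that make each clause true: POINTWISE on the open past for
  Type-I and for the DSS identity (given joint continuity of the `uₙ` and of `v`, which classical or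
  Oseen-mild fields have), LOCALLY UNIFORM on the single slice `t = −1` for the amplitude floor.
  Uniform convergence on the compact slab pieces `[−(n+2), −1/(n+2)] × B̄(0, n+2)` (the output of the
  tree's KNSS Lemma 6.1 engine) implies all of them.
* The DSS identity cannot be asked of the limit at `t ≥ 0`: hypotheses living on the open past do not
  see `v` there, and `IsRotatedDSS` relates `v(t, ·)` to `v(c'² t, ·)` for `t > 0` too; hence the
  `v t = 0 for t ≥ 0` normalisation (`isRotatedDSS_cutoff_of_Iio` for the cut-off field
  `fun t x => if t < 0 then v t x else 0`).

## References

* G. Koch, N. Nadirashvili, G. Seregin, V. Šverák, *Liouville theorems for the Navier–Stokes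
  equations and applications*, Acta Math. 203 (2009) 83–105 = arXiv:0709.3599: (1.6) (Type-I
  space–time bound), Lemma 6.1 and proof of Thm 6.2 (arXiv p. 13: limits keep the scale-invariant
  bound). [KochNadirashviliSereginSverak2009]
* D. Chae, J. Wolf, *Removing discretely self-similar singularities for the 3D Navier–Stokes
  equations*, Comm. PDE 42 (2017) = arXiv:1610.09464, Def. 1.1 (rotated DSS). [ChaeWolf2017]
* Z. Bradshaw, T.-P. Tsai, *Forward discretely self-similar solutions of the Navier–Stokes equations
  II*, Ann. Henri Poincaré 18 (2017) 1095–1119 = arXiv:1510.07504, §5.1, proof of Thm 1.3 (DSS with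
  factors `λ_k` passes to the limit `v`; nested factors give self-similarity). [BradshawTsai2017AHP]
* J. C. Oxtoby, *Measure and Category*, 2nd ed., GTM 2, Springer 1980, Ch. 7, Thm 7.3 and its proof
  (Baire's theorem on functions of the first class: the sets `E_n = ⋂_{i,j ≥ n} {|f_i − f_j| ≤ ε}` are
  closed, cover the space, so one contains an open set). [Oxtoby1980]
-/

noncomputable section

open MeasureTheory Set Function Filter TopologicalSpace Metric
open _root_.Topology
open scoped NNReal ENNReal

namespace Literature.Analysis.FluidPDE

/-! ### Type-I decay passes to pointwise limits; the amplitude floor sits at bounded radius -/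

section TypeI

variable {E : Type*} [NormedAddCommGroup E] {F : Type*} [NormedAddCommGroup F]

/-- **The Type-I class is closed under pointwise limits on the open past** (eventual form): if
eventually every `uₙ` obeys `‖uₙ(t, x)‖ ≤ C/(‖x‖ + √−t)` for `t < 0` and `uₙ(t, x) → v(t, x)` at every
point of the open past, then `v` obeys the same bound with the same constant — the step "the limit
`w` satisfies the bound" in KNSS's proof of Thm 6.2.
[cite: KochNadirashviliSereginSverak2009, (1.6) and proof of Thm 6.2 (arXiv p. 13)] -/
theorem HasTypeIDecay.of_eventually_tendsto {ι : Type*} {l : Filter ι} [l.NeBot] {C : ℝ}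
    {u : ι → ℝ → E → F} {v : ℝ → E → F} (hu : ∀ᶠ n in l, HasTypeIDecay C (u n))
    (hlim : ∀ t < 0, ∀ x, Tendsto (fun n => u n t x) l (𝓝 (v t x))) : HasTypeIDecay C v := by
  intro t ht x
  exact le_of_tendsto ((continuous_norm.tendsto _).comp (hlim t ht x))
    (hu.mono fun n hn => hn t ht x)

/-- **The Type-I class is closed under pointwise limits on the open past**: if every `uₙ` obeys
`‖uₙ(t, x)‖ ≤ C/(‖x‖ + √−t)` for `t < 0` and `uₙ(t, x) → v(t, x)` at every point of the open past,
then so does `v`, with the same constant.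
[cite: KochNadirashviliSereginSverak2009, (1.6) and proof of Thm 6.2 (arXiv p. 13)] -/
theorem HasTypeIDecay.of_tendsto {ι : Type*} {l : Filter ι} [l.NeBot] {C : ℝ}
    {u : ι → ℝ → E → F} {v : ℝ → E → F} (hu : ∀ n, HasTypeIDecay C (u n))
    (hlim : ∀ t < 0, ∀ x, Tendsto (fun n => u n t x) l (𝓝 (v t x))) : HasTypeIDecay C v :=
  HasTypeIDecay.of_eventually_tendsto (Eventually.of_forall hu) hlim

/-- **A Type-I amplitude floor sits at bounded parabolic radius**: if `‖u(t, x)‖ ≤ C/(‖x‖ + √−t)` on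
the open past and `0 < δ ≤ ‖u(t, x)‖` at some `t < 0`, then `‖x‖ + √−t ≤ C/δ`.
[cite: KochNadirashviliSereginSverak2009, (1.6)] -/
theorem HasTypeIDecay.norm_add_sqrt_le_div {C δ : ℝ} {u : ℝ → E → F} (h : HasTypeIDecay C u)
    (hδ : 0 < δ) {t : ℝ} (ht : t < 0) {x : E} (hx : δ ≤ ‖u t x‖) :
    ‖x‖ + Real.sqrt (-t) ≤ C / δ := by
  have hden : 0 < ‖x‖ + Real.sqrt (-t) :=
    add_pos_of_nonneg_of_pos (norm_nonneg _) (Real.sqrt_pos.2 (neg_pos.2 ht))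
  have h1 : δ ≤ C / (‖x‖ + Real.sqrt (-t)) := hx.trans (h t ht x)
  rw [le_div_iff₀ hden] at h1
  rw [le_div_iff₀ hδ]
  linarith [mul_comm δ (‖x‖ + Real.sqrt (-t))]

/-- At the slice `t = −1`: a Type-I field with `0 < δ ≤ ‖u(−1, x)‖` has `‖x‖ ≤ C/δ − 1` — the
amplitude floor of a window profile lies in the closed ball of radius `C/δ − 1`.
[cite: KochNadirashviliSereginSverak2009, (1.6)] -/
theorem HasTypeIDecay.norm_le_div_sub_one {C δ : ℝ} {u : ℝ → E → F} (h : HasTypeIDecay C u)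
    (hδ : 0 < δ) {x : E} (hx : δ ≤ ‖u (-1) x‖) : ‖x‖ ≤ C / δ - 1 := by
  have h1 := h.norm_add_sqrt_le_div hδ (by norm_num : (-1 : ℝ) < 0) hx
  rw [neg_neg, Real.sqrt_one] at h1
  linarith

/-- A Type-I field on the open past is bounded on every past slab `(−∞, t]`, `t < 0` (by
`C/√(−t)`); the form in which classical-to-mild bridges consume the bound.
[cite: KochNadirashviliSereginSverak2009, (1.4)–(1.6)] -/
theorem HasTypeIDecay.isBoundedOn_Iic {C : ℝ} {u : ℝ → E → F} (h : HasTypeIDecay C u)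
    {t : ℝ} (ht : t < 0) : IsBoundedOn (Iic t) u := by
  have hC : 0 ≤ C := by
    have h1 := h t ht 0
    have hden : 0 < ‖(0 : E)‖ + Real.sqrt (-t) := by
      rw [norm_zero, zero_add]; exact Real.sqrt_pos.2 (neg_pos.2 ht)
    exact (div_nonneg_iff.1 ((norm_nonneg _).trans h1)).elim (fun h => h.1)
      fun h => absurd h.2 (not_le.2 hden)
  refine ⟨C / Real.sqrt (-t), fun s hs x => (h s (lt_of_le_of_lt hs ht) x).trans ?_⟩
  have hst : Real.sqrt (-t) ≤ Real.sqrt (-s) := Real.sqrt_le_sqrt (by simpa using hs)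
  have hpos : 0 < Real.sqrt (-t) := Real.sqrt_pos.2 (neg_pos.2 ht)
  exact div_le_div_of_nonneg_left hC hpos (hst.trans (le_add_of_nonneg_left (norm_nonneg _)))

end TypeI

/-! ### The Baire-category device (Osgood; Oxtoby, Ch. 7, proof of Thm 7.3) -/

section Baire

variable {X : Type*} [PseudoMetricSpace X] [CompleteSpace X] {G : Type*} [NormedAddCommGroup G]

/-- **Osgood's lemma / Baire's theorem on functions of the first class, quantitative form.** Let
`fₙ` (`n ∈ ℕ`) and `g` be maps on a complete (pseudo)metric space, all continuous on an open set `U`,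
with `fₙ z → g z` at every `z ∈ U`. Then for every closed ball `B̄(z₀, ρ) ⊆ U` (`ρ > 0`) and every
`ε > 0` there are an open ball `B(w, r) ⊆ B(z₀, ρ)` and an index `N` such that
`‖fₙ z − g z‖ ≤ ε` for all `z ∈ B(w, r)` and all `n ≥ N`. Proof as in Oxtoby: the closed sets
`F_N = B(z₀,ρ)ᶜ ∪ ⋂_{n ≥ N} {z ∈ B̄(z₀,ρ) : ‖fₙ z − g z‖ ≤ ε}` cover the space, so by the Baire
category theorem the union of their interiors is dense and meets `B(z₀, ρ)`.
[cite: Oxtoby1980, Ch. 7, proof of Thm 7.3] -/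
theorem exists_ball_forall_norm_sub_le_of_tendsto {f : ℕ → X → G} {g : X → G} {U : Set X}
    (hU : IsOpen U) (hf : ∀ n, ContinuousOn (f n) U) (hg : ContinuousOn g U)
    (hlim : ∀ z ∈ U, Tendsto (fun n => f n z) atTop (𝓝 (g z)))
    {z₀ : X} {ρ : ℝ} (hρ : 0 < ρ) (hK : closedBall z₀ ρ ⊆ U) {ε : ℝ} (hε : 0 < ε) :
    ∃ (w : X) (r : ℝ) (N : ℕ), 0 < r ∧ ball w r ⊆ ball z₀ ρ ∧
      ∀ z ∈ ball w r, ∀ n ≥ N, ‖f n z - g z‖ ≤ ε := by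
  have _hU := hU
  have hOK : ball z₀ ρ ⊆ closedBall z₀ ρ := ball_subset_closedBall
  -- the closed pieces `S n = {z ∈ B̄ : ‖f n z - g z‖ ≤ ε}`
  have hSc : ∀ n, IsClosed (closedBall z₀ ρ ∩ (fun z => f n z - g z) ⁻¹' closedBall (0 : G) ε) :=
    fun n => (((hf n).mono hK).sub (hg.mono hK)).preimage_isClosed_of_isClosed isClosed_closedBall
      isClosed_closedBall
  -- the closed sets `F N`
  set F : ℕ → Set X := fun N => (ball z₀ ρ)ᶜ ∪
    ⋂ n, ⋂ (_ : N ≤ n), (closedBall z₀ ρ ∩ (fun z => f n z - g z) ⁻¹' closedBall (0 : G) ε) with hF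
  have hFc : ∀ N, IsClosed (F N) := fun N =>
    isOpen_ball.isClosed_compl.union (isClosed_iInter fun n => isClosed_iInter fun _ => hSc n)
  have hcover : ⋃ N, F N = univ := by
    refine eq_univ_of_forall fun z => ?_
    by_cases hz : z ∈ ball z₀ ρ
    · obtain ⟨N, hN⟩ := Metric.tendsto_atTop.1 (hlim z (hK (hOK hz))) ε hε
      refine mem_iUnion.2 ⟨N, Or.inr (mem_iInter₂.2 fun n hn => ⟨hOK hz, ?_⟩)⟩
      show f n z - g z ∈ closedBall (0 : G) ε
      rw [mem_closedBall_zero_iff, ← dist_eq_norm]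
      exact (hN n hn).le
    · exact mem_iUnion.2 ⟨0, Or.inl hz⟩
  have hdense : Dense (⋃ N, interior (F N)) := dense_iUnion_interior_of_closed hFc hcover
  obtain ⟨w, hw, hwO⟩ := hdense.exists_mem_open isOpen_ball ⟨z₀, mem_ball_self hρ⟩
  obtain ⟨N, hwN⟩ := mem_iUnion.1 hw
  obtain ⟨r₁, hr₁, hball₁⟩ := Metric.mem_nhds_iff.1 (mem_interior_iff_mem_nhds.1 hwN)
  obtain ⟨r₂, hr₂, hball₂⟩ := Metric.mem_nhds_iff.1 (isOpen_ball.mem_nhds hwO)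
  refine ⟨w, min r₁ r₂, N, lt_min hr₁ hr₂,
    fun z hz => hball₂ (ball_subset_ball (min_le_right _ _) hz), fun z hz n hn => ?_⟩
  have hzO : z ∈ ball z₀ ρ := hball₂ (ball_subset_ball (min_le_right _ _) hz)
  have hzF : z ∈ F N := hball₁ (ball_subset_ball (min_le_left _ _) hz)
  rcases hzF with hzF | hzF
  · exact absurd hzO hzF
  · have h2 := ((mem_iInter₂.1 hzF) n hn).2
    have h3 : f n z - g z ∈ closedBall (0 : G) ε := h2
    rwa [mem_closedBall_zero_iff] at h3

end Baire

/-! ### Rotated-DSS structure passes to pointwise limits with converging factors and rotations -/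

section DSSLimit

variable {E : Type*} [NormedAddCommGroup E] [NormedSpace ℝ E]

/-- **Pointwise convergence of linear isometries passes to the inverses along moving points**: if
`Rₙ x → R' x` for every `x` and `yₙ → y`, then `Rₙ⁻¹ yₙ → R'⁻¹ y` — since
`‖Rₙ⁻¹ yₙ − R'⁻¹ y‖ ≤ ‖yₙ − y‖ + ‖y − Rₙ R'⁻¹ y‖` (isometries are `1`-Lipschitz; no locally uniform
upgrade of `Rₙ → R'` is needed). [cite: ChaeWolf2017, Def. 1.1] -/
theorem tendsto_linearIsometryEquiv_symm {ι : Type*} {l : Filter ι}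
    {R : ι → E ≃ₗᵢ[ℝ] E} {R' : E ≃ₗᵢ[ℝ] E} (hR : ∀ x, Tendsto (fun n => R n x) l (𝓝 (R' x)))
    {y : ι → E} {y' : E} (hy : Tendsto y l (𝓝 y')) :
    Tendsto (fun n => (R n).symm (y n)) l (𝓝 (R'.symm y')) := by
  rw [tendsto_iff_norm_sub_tendsto_zero]
  have ha : Tendsto (fun n => ‖y n - y'‖) l (𝓝 0) := tendsto_iff_norm_sub_tendsto_zero.1 hy
  have hb : Tendsto (fun n => ‖y' - R n (R'.symm y')‖) l (𝓝 0) := by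
    have h1 := tendsto_iff_norm_sub_tendsto_zero.1 (hR (R'.symm y'))
    simpa only [LinearIsometryEquiv.apply_symm_apply, norm_sub_rev] using h1
  have hab : Tendsto (fun n => ‖y n - y'‖ + ‖y' - R n (R'.symm y')‖) l (𝓝 0) := by
    simpa using ha.add hb
  refine squeeze_zero (fun n => norm_nonneg _) (fun n => ?_) hab
  calc ‖(R n).symm (y n) - R'.symm y'‖
      = ‖(R n) ((R n).symm (y n) - R'.symm y')‖ := ((R n).norm_map _).symm
    _ = ‖(y n - y') + (y' - R n (R'.symm y'))‖ := by
        rw [map_sub, LinearIsometryEquiv.apply_symm_apply]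
        congr 1
        abel
    _ ≤ ‖y n - y'‖ + ‖y' - R n (R'.symm y')‖ := norm_add_le _ _

variable [FiniteDimensional ℝ E]

/-- **The rotated-DSS identity passes to pointwise limits with converging factors and rotations.**
Let `uₙ : ℝ → E → E` be jointly continuous on the open past `(−∞, 0) × E` and satisfy there the
rotated-DSS identity `cₙ Rₙ⁻¹ uₙ(cₙ² t, cₙ Rₙ x) = uₙ(t, x)` (`t < 0`), with factors `cₙ → c' > 0`
and linear isometries `Rₙ → R'` pointwise; let `uₙ → v` POINTWISE on the open past, `v` jointly
continuous there. Then `c' R'⁻¹ v(c'² t, c' R' x) = v(t, x)` for all `t < 0` and `x`. (Bradshaw–Tsai: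
"`v_l` is DSS with scaling factor `λ_k`, and this property is inherited by `v`"; here the factors and
rotations may vary, and the values of `uₙ` at the moving points `(cₙ² t, cₙ Rₙ x)` are controlled by
the Baire-category device `exists_ball_forall_norm_sub_le_of_tendsto` plus continuity of `v`.)
[cite: BradshawTsai2017AHP, §5.1, proof of Thm 1.3] -/
theorem rotatedDSS_Iio_of_tendsto {c : ℕ → ℝ} {c' : ℝ} {R : ℕ → E ≃ₗᵢ[ℝ] E} {R' : E ≃ₗᵢ[ℝ] E}
    {u : ℕ → ℝ → E → E} {v : ℝ → E → E}
    (hc' : 0 < c') (hc : Tendsto c atTop (𝓝 c'))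
    (hR : ∀ x, Tendsto (fun n => R n x) atTop (𝓝 (R' x)))
    (hdss : ∀ n, ∀ t < 0, ∀ x, c n • (R n).symm (u n (c n ^ 2 * t) (c n • R n x)) = u n t x)
    (hcont : ∀ n, ContinuousOn (uncurry (u n)) (Iio 0 ×ˢ univ))
    (hv : ContinuousOn (uncurry v) (Iio 0 ×ˢ univ))
    (hlim : ∀ t < 0, ∀ x, Tendsto (fun n => u n t x) atTop (𝓝 (v t x))) :
    ∀ t < 0, ∀ x, c' • R'.symm (v (c' ^ 2 * t) (c' • R' x)) = v t x := by
  haveI : CompleteSpace E := FiniteDimensional.complete ℝ E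
  -- the open past
  have hPo : IsOpen (Iio (0 : ℝ) ×ˢ (univ : Set E)) := isOpen_Iio.prod isOpen_univ
  have hc'0 : c' ≠ 0 := hc'.ne'
  -- the scaling map `Φ` and its inverse `Ψ`
  obtain ⟨Φ, hΦ⟩ : ∃ Φ : ℝ × E → ℝ × E, Φ = fun p => (c' ^ 2 * p.1, c' • R' p.2) := ⟨_, rfl⟩
  obtain ⟨Ψ, hΨ⟩ : ∃ Ψ : ℝ × E → ℝ × E, Ψ = fun z => (z.1 / c' ^ 2, c'⁻¹ • R'.symm z.2) :=
    ⟨_, rfl⟩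
  have hΦΨ : ∀ z, Φ (Ψ z) = z := fun z => by
    rw [hΦ, hΨ]
    ext1
    · show c' ^ 2 * (z.1 / c' ^ 2) = z.1
      field_simp
    · show c' • R' (c'⁻¹ • R'.symm z.2) = z.2
      rw [LinearIsometryEquiv.map_smul, smul_smul, mul_inv_cancel₀ hc'0, one_smul,
        LinearIsometryEquiv.apply_symm_apply]
  have hΨΦ : ∀ p, Ψ (Φ p) = p := fun p => by
    rw [hΦ, hΨ]
    ext1
    · show c' ^ 2 * p.1 / c' ^ 2 = p.1
      field_simp
    · show c'⁻¹ • R'.symm (c' • R' p.2) = p.2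
      rw [LinearIsometryEquiv.map_smul, smul_smul, inv_mul_cancel₀ hc'0, one_smul,
        LinearIsometryEquiv.symm_apply_apply]
  have hΦc : Continuous Φ := by
    rw [hΦ]
    exact (continuous_const.mul continuous_fst).prodMk
      ((R'.continuous.comp continuous_snd).const_smul c')
  have hΨc : Continuous Ψ := by
    rw [hΨ]
    exact (continuous_fst.div_const _).prodMk ((R'.symm.continuous.comp continuous_snd).const_smul c'⁻¹)
  have hΦP : MapsTo Φ (Iio (0 : ℝ) ×ˢ (univ : Set E)) (Iio (0 : ℝ) ×ˢ (univ : Set E)) := by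
    intro p hp
    rw [hΦ]
    exact ⟨mul_neg_of_pos_of_neg (pow_pos hc' 2) hp.1, mem_univ _⟩
  have hΨP : MapsTo Ψ (Iio (0 : ℝ) ×ˢ (univ : Set E)) (Iio (0 : ℝ) ×ˢ (univ : Set E)) := by
    intro z hz
    rw [hΨ]
    exact ⟨div_neg_of_neg_of_pos hz.1 (pow_pos hc' 2), mem_univ _⟩
  -- the defect `g p = c' R'⁻¹ v(Φ p) − v p`
  obtain ⟨g, hg⟩ : ∃ g : ℝ × E → E, g = fun p => c' • R'.symm (uncurry v (Φ p)) - uncurry v p :=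
    ⟨_, rfl⟩
  have hgc : ContinuousOn g (Iio (0 : ℝ) ×ˢ (univ : Set E)) := by
    have h1 : ContinuousOn (fun p => uncurry v (Φ p)) (Iio (0 : ℝ) ×ˢ (univ : Set E)) :=
      hv.comp hΦc.continuousOn hΦP
    have h2 : ContinuousOn (fun p => c' • R'.symm (uncurry v (Φ p))) (Iio (0 : ℝ) ×ˢ univ) :=
      (R'.symm.continuous.comp_continuousOn h1).const_smul c'
    rw [hg]
    exact h2.sub hv
  -- ### key estimate: `‖g p₀‖ ≤ (c' + 1) ε` for every `ε > 0`
  have key : ∀ p₀ ∈ Iio (0 : ℝ) ×ˢ (univ : Set E), ∀ ε > 0, ‖g p₀‖ ≤ (c' + 1) * ε := by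
    intro p₀ hp₀ ε hε
    -- continuity of `g` at `p₀`
    obtain ⟨η, hη, hgη⟩ := Metric.continuousAt_iff.1 (hgc.continuousAt (hPo.mem_nhds hp₀)) ε hε
    -- continuity of `Ψ` at `z₀ = Φ p₀`
    have hz₀P : Φ p₀ ∈ Iio (0 : ℝ) ×ˢ (univ : Set E) := hΦP hp₀
    obtain ⟨ρ₁, hρ₁, hΨρ⟩ := Metric.continuousAt_iff.1 (hΨc.continuousAt (x := Φ p₀)) η hη
    -- a closed ball around `z₀` inside the open past
    obtain ⟨ρ₂, hρ₂, hballP⟩ := Metric.nhds_basis_closedBall.mem_iff.1 (hPo.mem_nhds hz₀P)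
    have hρ : 0 < min ρ₁ ρ₂ := lt_min hρ₁ hρ₂
    have hKP : closedBall (Φ p₀) (min ρ₁ ρ₂) ⊆ Iio (0 : ℝ) ×ˢ (univ : Set E) :=
      (closedBall_subset_closedBall (min_le_right _ _)).trans hballP
    -- the Baire step
    obtain ⟨w, r, N, hr, hwball, hW⟩ := exists_ball_forall_norm_sub_le_of_tendsto
      (f := fun n => uncurry (u n)) (g := uncurry v) hPo hcont hv
      (fun z hz => hlim z.1 hz.1 z.2) hρ hKP hε
    have hwO : w ∈ ball (Φ p₀) (min ρ₁ ρ₂) := hwball (mem_ball_self hr)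
    have hwP : w ∈ Iio (0 : ℝ) ×ˢ (univ : Set E) := hKP (ball_subset_closedBall hwO)
    -- the point `p = Ψ w`, with `Φ p = w`
    have hpP : Ψ w ∈ Iio (0 : ℝ) ×ˢ (univ : Set E) := hΨP hwP
    have hΦp : Φ (Ψ w) = w := hΦΨ w
    -- Claim: `‖g (Ψ w)‖ ≤ c' ε` (moving points)
    have hB : ‖g (Ψ w)‖ ≤ c' * ε := by
      have hzn : Tendsto (fun n => ((c n ^ 2 * (Ψ w).1, c n • R n (Ψ w).2) : ℝ × E)) atTop
          (𝓝 w) := by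
        have h1 : Tendsto (fun n => ((c n ^ 2 * (Ψ w).1, c n • R n (Ψ w).2) : ℝ × E)) atTop
            (𝓝 (c' ^ 2 * (Ψ w).1, c' • R' (Ψ w).2)) :=
          ((hc.pow 2).mul_const _).prodMk_nhds (hc.smul (hR _))
        have h2 : ((c' ^ 2 * (Ψ w).1, c' • R' (Ψ w).2) : ℝ × E) = w := by
          have h3 := hΦΨ w
          simp only [hΦ] at h3
          exact h3
        rwa [h2] at h1
      have hev1 : ∀ᶠ n in atTop, ((c n ^ 2 * (Ψ w).1, c n • R n (Ψ w).2) : ℝ × E) ∈ ball w r :=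
        hzn.eventually_mem (isOpen_ball.mem_nhds (mem_ball_self hr))
      have hev : ∀ᶠ n in atTop,
          ‖c n • (R n).symm (v (c n ^ 2 * (Ψ w).1) (c n • R n (Ψ w).2)) - u n (Ψ w).1 (Ψ w).2‖ ≤
            |c n| * ε := by
        filter_upwards [hev1, eventually_ge_atTop N] with n hn hnN
        have hWn := hW _ hn n hnN
        rw [← hdss n (Ψ w).1 hpP.1 (Ψ w).2, ← smul_sub, ← map_sub, norm_smul, Real.norm_eq_abs,
          LinearIsometryEquiv.norm_map]
        gcongr
        rw [norm_sub_rev]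
        exact hWn
      have hA : Tendsto (fun n => c n • (R n).symm (v (c n ^ 2 * (Ψ w).1) (c n • R n (Ψ w).2)) -
          u n (Ψ w).1 (Ψ w).2) atTop (𝓝 (g (Ψ w))) := by
        have hvz : Tendsto (fun n => uncurry v ((c n ^ 2 * (Ψ w).1, c n • R n (Ψ w).2) : ℝ × E))
            atTop (𝓝 (uncurry v w)) :=
          ((hv.continuousAt (hPo.mem_nhds hwP)).tendsto).comp hzn
        have h1 : Tendsto (fun n => c n • (R n).symm (v (c n ^ 2 * (Ψ w).1) (c n • R n (Ψ w).2)))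
            atTop (𝓝 (c' • R'.symm (uncurry v w))) :=
          hc.smul (tendsto_linearIsometryEquiv_symm hR hvz)
        have h2 := h1.sub (hlim (Ψ w).1 hpP.1 (Ψ w).2)
        have h3 : g (Ψ w) = c' • R'.symm (uncurry v w) - v (Ψ w).1 (Ψ w).2 := by
          rw [hg]
          simp only [hΦp, uncurry]
        rwa [h3]
      have hB' : Tendsto (fun n => |c n| * ε) atTop (𝓝 (|c'| * ε)) :=
        ((continuous_abs.tendsto c').comp hc).mul_const ε
      have h4 := le_of_tendsto_of_tendsto hA.norm hB' hev
      rwa [abs_of_pos hc'] at h4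
    -- conclude with the continuity of `g` at `p₀`
    have hdist : dist (Ψ w) p₀ < η := by
      have h1 : dist w (Φ p₀) < ρ₁ := lt_of_lt_of_le (mem_ball.1 hwO) (min_le_left _ _)
      have h2 := hΨρ h1
      rwa [hΨΦ p₀] at h2
    have hgd : dist (g (Ψ w)) (g p₀) < ε := hgη hdist
    rw [dist_eq_norm] at hgd
    calc ‖g p₀‖ = ‖g (Ψ w) - (g (Ψ w) - g p₀)‖ := by rw [sub_sub_cancel]
      _ ≤ ‖g (Ψ w)‖ + ‖g (Ψ w) - g p₀‖ := norm_sub_le _ _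
      _ ≤ c' * ε + ε := add_le_add hB hgd.le
      _ = (c' + 1) * ε := by ring
  -- ### hence `g = 0` on the open past
  have hzero : ∀ p₀ ∈ Iio (0 : ℝ) ×ˢ (univ : Set E), g p₀ = 0 := by
    intro p₀ hp₀
    by_contra hne
    have hpos : 0 < ‖g p₀‖ := norm_pos_iff.2 hne
    have hc1 : 0 < c' + 1 := by linarith
    have h1 := key p₀ hp₀ (‖g p₀‖ / (2 * (c' + 1))) (by positivity)
    have h2 : (c' + 1) * (‖g p₀‖ / (2 * (c' + 1))) = ‖g p₀‖ / 2 := by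
      field_simp
    linarith
  intro t ht x
  have h1 := hzero (t, x) ⟨ht, mem_univ _⟩
  rw [hg] at h1
  simp only [hΦ, uncurry] at h1
  exact sub_eq_zero.1 h1

/-- `rotatedDSS_Iio_of_tendsto` with the hypothesis in the tree's form `IsRotatedDSS (cₙ) (Rₙ) (uₙ)`
(Chae–Wolf 2017, Def. 1.1): rotated-DSS, jointly continuous approximants converging pointwise on the
open past to a jointly continuous field, with `cₙ → c' > 0` and `Rₙ → R'` pointwise, leave the DSS
identity with factor `c'` and rotation `R'` on the open past. [cite: ChaeWolf2017, Def. 1.1] -/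
theorem rotatedDSS_Iio_of_isRotatedDSS_tendsto {c : ℕ → ℝ} {c' : ℝ} {R : ℕ → E ≃ₗᵢ[ℝ] E}
    {R' : E ≃ₗᵢ[ℝ] E} {u : ℕ → ℝ → E → E} {v : ℝ → E → E}
    (hc' : 0 < c') (hc : Tendsto c atTop (𝓝 c'))
    (hR : ∀ x, Tendsto (fun n => R n x) atTop (𝓝 (R' x)))
    (hdss : ∀ n, IsRotatedDSS (c n) (R n) (u n))
    (hcont : ∀ n, ContinuousOn (uncurry (u n)) (Iio 0 ×ˢ univ))
    (hv : ContinuousOn (uncurry v) (Iio 0 ×ˢ univ))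
    (hlim : ∀ t < 0, ∀ x, Tendsto (fun n => u n t x) atTop (𝓝 (v t x))) :
    ∀ t < 0, ∀ x, c' • R'.symm (v (c' ^ 2 * t) (c' • R' x)) = v t x :=
  rotatedDSS_Iio_of_tendsto hc' hc hR (fun n t _ x => hdss n t x) hcont hv hlim

omit [FiniteDimensional ℝ E] in
/-- **From the identity on the past to `IsRotatedDSS`.** The tree's `IsRotatedDSS c R v` quantifies
over all `t ∈ ℝ`; a field satisfying the rotated-DSS identity for `t < 0` and VANISHING for `t ≥ 0`
is rotated-DSS (for `t ≥ 0` also `c² t ≥ 0`, so both sides are `0`).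
[cite: ChaeWolf2017, Def. 1.1] -/
theorem isRotatedDSS_of_Iio_of_eq_zero {c : ℝ} {R : E ≃ₗᵢ[ℝ] E} {v : ℝ → E → E}
    (hneg : ∀ t < 0, ∀ x, c • R.symm (v (c ^ 2 * t) (c • R x)) = v t x)
    (hpos : ∀ t, 0 ≤ t → v t = 0) : IsRotatedDSS c R v := by
  intro t x
  rcases lt_or_ge t 0 with ht | ht
  · exact hneg t ht x
  · have h1 : v t = 0 := hpos t ht
    have h2 : v (c ^ 2 * t) = 0 := hpos _ (mul_nonneg (sq_nonneg c) ht)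
    rw [h1, h2, Pi.zero_apply, Pi.zero_apply, map_zero, smul_zero]

omit [FiniteDimensional ℝ E] in
/-- **The past cut-off of a field obeying the DSS identity on the past is rotated-DSS**: for `c ≠ 0`,
`fun t x => if t < 0 then v t x else 0` is `IsRotatedDSS c R` as soon as
`c R⁻¹ v(c² t, c R x) = v(t, x)` for `t < 0` (then `c² t < 0 ↔ t < 0`).
[cite: ChaeWolf2017, Def. 1.1] -/
theorem isRotatedDSS_cutoff_of_Iio {c : ℝ} (hc : c ≠ 0) {R : E ≃ₗᵢ[ℝ] E} {v : ℝ → E → E}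
    (hneg : ∀ t < 0, ∀ x, c • R.symm (v (c ^ 2 * t) (c • R x)) = v t x) :
    IsRotatedDSS c R (fun t x => if t < 0 then v t x else 0) := by
  refine isRotatedDSS_of_Iio_of_eq_zero (fun t ht x => ?_) (fun t ht => ?_)
  · have hct : c ^ 2 * t < 0 := mul_neg_of_pos_of_neg (by positivity) ht
    simp only [if_pos ht, if_pos hct]
    exact hneg t ht x
  · funext x
    simp [not_lt.2 ht]

omit [NormedSpace ℝ E] [FiniteDimensional ℝ E] in
/-- The past cut-off agrees with the field on the open past (bookkeeping for consumers that carry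
slice-wise hypotheses at `t < 0`). [cite: ChaeWolf2017, Def. 1.1] -/
theorem cutoff_apply_of_neg {v : ℝ → E → E} {t : ℝ} (ht : t < 0) :
    (fun s x => if s < 0 then v s x else (0 : E)) t = v t := by
  funext x
  simp [ht]

omit [NormedSpace ℝ E] [FiniteDimensional ℝ E] in
/-- The past cut-off vanishes on `t ≥ 0`. [cite: ChaeWolf2017, Def. 1.1] -/
theorem cutoff_apply_of_nonneg {v : ℝ → E → E} {t : ℝ} (ht : 0 ≤ t) :
    (fun s x => if s < 0 then v s x else (0 : E)) t = 0 := by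
  funext x
  simp [not_lt.2 ht]

end DSSLimit

/-! ### The amplitude floor survives locally uniform convergence; non-triviality of the limit -/

section Amplitude

variable {E : Type*} [NormedAddCommGroup E] [NormedSpace ℝ E] [FiniteDimensional ℝ E]
  {F : Type*} [NormedAddCommGroup F]

/-- **An amplitude floor at bounded points survives locally uniform convergence.** If
`δ ≤ ‖fₙ(xₙ)‖` with `‖xₙ‖ ≤ ρ` and `fₙ → g` locally uniformly with `g` continuous, then
`δ ≤ ‖g(a)‖` at some `‖a‖ ≤ ρ` (Bolzano–Weierstrass on the `xₙ`, then `fₙₖ(xₙₖ) → g(a)`). This is the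
non-triviality step of the limit in a Type-I (r)DSS extraction: the floor of a window profile sits at
radius `≤ C₀/δ − 1` (`HasTypeIDecay.norm_le_div_sub_one`).
[cite: KochNadirashviliSereginSverak2009, proof of Thm 6.2 (arXiv p. 13)] -/
theorem exists_le_norm_of_tendstoLocallyUniformly {f : ℕ → E → F} {g : E → F} {x : ℕ → E}
    {δ ρ : ℝ} (hx : ∀ n, ‖x n‖ ≤ ρ) (hfx : ∀ n, δ ≤ ‖f n (x n)‖)
    (hlim : TendstoLocallyUniformly f g atTop) (hg : Continuous g) :
    ∃ a : E, ‖a‖ ≤ ρ ∧ δ ≤ ‖g a‖ := by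
  obtain ⟨a, ha, φ, hφ, hxa⟩ := tendsto_subseq_of_bounded (isBounded_closedBall (x := (0 : E))
    (r := ρ)) (fun n => mem_closedBall_zero_iff.2 (hx n))
  rw [isClosed_closedBall.closure_eq, mem_closedBall_zero_iff] at ha
  have hlim' : TendstoLocallyUniformly (fun k => f (φ k)) g atTop := fun U hU y => by
    obtain ⟨t, ht, hev⟩ := hlim U hU y
    exact ⟨t, ht, hφ.tendsto_atTop.eventually hev⟩
  have hconv : Tendsto (fun k => f (φ k) (x (φ k))) atTop (𝓝 (g a)) :=
    hlim'.tendsto_comp hg.continuousAt hxa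
  exact ⟨a, ha, ge_of_tendsto' hconv.norm fun k => hfx (φ k)⟩

end Amplitude

section NotAEZero

variable {α : Type*} [TopologicalSpace α] [MeasurableSpace α] {F : Type*} [NormedAddCommGroup F]

/-- **A continuous field that is nonzero at one point is not a.e. zero** for a measure positive on
open sets (Lebesgue measure on `ℝ³`): `{g ≠ 0}` is a non-empty open set. The form in which the
non-triviality `¬ (v(−1) =ᵐ 0)` of an extracted profile is concluded.
[cite: KochNadirashviliSereginSverak2009, proof of Thm 6.2 (arXiv p. 13)] -/
theorem not_ae_eq_zero_of_continuous_of_ne {μ : Measure α} [μ.IsOpenPosMeasure] {g : α → F}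
    (hg : Continuous g) {a : α} (ha : g a ≠ 0) : ¬ g =ᵐ[μ] 0 := fun h =>
  ha (congrFun ((hg.ae_eq_iff_eq μ continuous_const).1 h) a)

end NotAEZero

/-! ### Slices of fields continuous on the open past -/

section Slices

variable {E : Type*} [TopologicalSpace E] {F : Type*} [TopologicalSpace F]

/-- A field jointly continuous on the open past `(−∞, 0) × E` has continuous slices `v t`, `t < 0`.
[cite: KochNadirashviliSereginSverak2009, Lemma 6.1 (arXiv p. 11)] -/
theorem continuous_slice_of_continuousOn_Iio {v : ℝ → E → F}
    (hv : ContinuousOn (uncurry v) (Iio 0 ×ˢ univ)) {t : ℝ} (ht : t < 0) : Continuous (v t) :=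
  hv.comp_continuous (Continuous.prodMk_right t) fun x => ⟨ht, mem_univ x⟩

/-- A field jointly continuous on the open past has a.e.-strongly measurable slices `v t`, `t < 0`
(any Borel measure). [cite: KochNadirashviliSereginSverak2009, Lemma 6.1 (arXiv p. 11)] -/
theorem aestronglyMeasurable_slice_of_continuousOn_Iio [MeasurableSpace E] [OpensMeasurableSpace E]
    [PseudoMetrizableSpace F] [SecondCountableTopology F] {μ : Measure E} {v : ℝ → E → F}
    (hv : ContinuousOn (uncurry v) (Iio 0 ×ˢ univ)) {t : ℝ} (ht : t < 0) :
    AEStronglyMeasurable (v t) μ :=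
  (continuous_slice_of_continuousOn_Iio hv ht).aestronglyMeasurable

end Slices

/-! ### Assembly: the structure of a Type-I rotated-DSS window sequence passes to its limit -/

section Assembly

variable {E : Type*} [NormedAddCommGroup E] [NormedSpace ℝ E] [FiniteDimensional ℝ E]
  [MeasurableSpace E] [BorelSpace E]

/-- **STRUCTURE PASSES TO THE LIMIT.** Let `uₙ : ℝ → E → E` be fields jointly continuous on the open
past, rotated-DSS with factors `cₙ ≥ c_min > 1` and isometries `Rₙ`, Type-I with a common constant
`C₀`, each with an amplitude floor `δ ≤ ‖uₙ(−1, xₙ)‖` (`δ > 0`) somewhere on the slice `t = −1` — the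
WINDOW PROFILES of a Type-I (r)DSS extraction. Suppose `cₙ → c'`, `Rₙ → R'` pointwise, and `uₙ → v`
pointwise on the open past and locally uniformly on the slice `t = −1`, where `v` is jointly
continuous on the open past and vanishes on `t ≥ 0`. Then the limit has the same structure:
`1 < c'`, `v` is rotated-DSS with factor `c'` and rotation `R'` (`rotatedDSS_Iio_of_tendsto`, a
Baire-category argument, plus the cut-off normalisation), Type-I with constant `C₀`, its past slices
are a.e.-strongly measurable (any Borel measure `μ`), the amplitude floor survives
(`∃ x, δ ≤ ‖v(−1, x)‖`), and hence `v` is NOT a.e. zero on the past for any `μ` positive on open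
sets. The ancient-mild clause of such statements is equation-specific and not part of this lemma.
[cite: KochNadirashviliSereginSverak2009, proof of Thm 6.2 (arXiv p. 13)]
[cite: BradshawTsai2017AHP, §5.1, proof of Thm 1.3] -/
theorem typeI_rotatedDSS_structure_of_tendsto {μ : Measure E} [μ.IsOpenPosMeasure]
    {c : ℕ → ℝ} {c' cmin C₀ δ : ℝ} {R : ℕ → E ≃ₗᵢ[ℝ] E} {R' : E ≃ₗᵢ[ℝ] E}
    {u : ℕ → ℝ → E → E} {v : ℝ → E → E}
    (hcmin : 1 < cmin) (hδ : 0 < δ) (hcn : ∀ n, cmin ≤ c n) (hc : Tendsto c atTop (𝓝 c'))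
    (hR : ∀ x, Tendsto (fun n => R n x) atTop (𝓝 (R' x)))
    (hdss : ∀ n, IsRotatedDSS (c n) (R n) (u n)) (hI : ∀ n, HasTypeIDecay C₀ (u n))
    (hcont : ∀ n, ContinuousOn (uncurry (u n)) (Iio 0 ×ˢ univ))
    (hamp : ∀ n, ∃ x, δ ≤ ‖u n (-1) x‖)
    (hv : ContinuousOn (uncurry v) (Iio 0 ×ˢ univ)) (hv0 : ∀ t, 0 ≤ t → v t = 0)
    (hlim : ∀ t < 0, ∀ x, Tendsto (fun n => u n t x) atTop (𝓝 (v t x)))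
    (hloc : TendstoLocallyUniformly (fun n => u n (-1)) (v (-1)) atTop) :
    1 < c' ∧ IsRotatedDSS c' R' v ∧ HasTypeIDecay C₀ v ∧
      (∀ t < 0, AEStronglyMeasurable (v t) μ) ∧ (∃ x, δ ≤ ‖v (-1) x‖) ∧
      ¬ (∀ t < 0, v t =ᵐ[μ] 0) := by
  have hc' : 1 < c' := lt_of_lt_of_le hcmin (ge_of_tendsto' hc hcn)
  have hc'0 : 0 < c' := by linarith
  -- the DSS identity on the past, then `IsRotatedDSS` by the normalisation on `t ≥ 0`
  have hneg := rotatedDSS_Iio_of_isRotatedDSS_tendsto hc'0 hc hR hdss hcont hv hlim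
  have hDSS : IsRotatedDSS c' R' v := isRotatedDSS_of_Iio_of_eq_zero hneg hv0
  -- Type-I
  have hTI : HasTypeIDecay C₀ v := HasTypeIDecay.of_tendsto hI hlim
  -- the amplitude floor
  choose x hx using hamp
  have hxb : ∀ n, ‖x n‖ ≤ C₀ / δ - 1 := fun n => (hI n).norm_le_div_sub_one hδ (hx n)
  have hvc : Continuous (v (-1)) := continuous_slice_of_continuousOn_Iio hv (by norm_num)
  obtain ⟨a, -, ha⟩ := exists_le_norm_of_tendstoLocallyUniformly hxb hx hloc hvc
  refine ⟨hc', hDSS, hTI, fun t ht => aestronglyMeasurable_slice_of_continuousOn_Iio hv ht,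
    ⟨a, ha⟩, fun hae => ?_⟩
  have hne : v (-1) a ≠ 0 := norm_pos_iff.1 (lt_of_lt_of_le hδ ha)
  exact not_ae_eq_zero_of_continuous_of_ne hvc hne (hae (-1) (by norm_num))

end Assembly

end Literature.Analysis.FluidPDE

end
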